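import Summits.BirchSwinnertonDyer.BirchSwinnertonDyer.Theorems.PublishedInputsAdditiveKolyOfSeven
import Summits.BirchSwinnertonDyer.BirchSwinnertonDyer.Theses.AdditiveKolyvaginRoad
import Summits.BirchSwinnertonDyer.BirchSwinnertonDyer.Theses.TeichmullerTwistDescent
import Summits.BirchSwinnertonDyer.BirchSwinnertonDyer.Theses.EdixhovenFibreFiveSeven
import HarnessLib

set_option linter.dupNamespace false -- `…BirchSwinnertonDyer.BirchSwinnertonDyer…` is the cell's nested layout (D-0017)
set_option autoImplicit false

/-!
# Item 20137 `PublishedInputsAdditiveKoly` BY NAME on its three routes, from seven print inputs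
# (LADDER-BSD D-0154 (2), INPUTS-LIST-1 v2 TRANCHE ENTRY #1 «N6», by-name doors)

Seat `bsd-inputs-honda-p1` (gen 6), `--supports` stmt-BirchSwinnertonDyer-20137. The route-free collapse term is
`Theorems.PublishedInputsAdditiveKolySlim.publishedInputsAdditiveKoly_of_seven` (module
`Theorems.PublishedInputsAdditiveKolyOfSeven`, item signature verbatim); this leaf file only records it against the three
route declarations that carry item 20137 — `Theses.AdditiveKolyvaginRoad.PublishedInputsAdditiveKoly` (support r9 of
`AdditiveKolyvaginRoad`), `Theses.TeichmullerTwistDescent.PublishedInputsAdditiveKoly`,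
`Theses.EdixhovenFibreFiveSeven.PublishedInputsAdditiveKoly` (each a `def … : Prop :=` alias of the same ten-conjunct
body) — by `exact` (definitional unfolding). Route pens re-keying a `closes` binder import the ROUTE-FREE module, not this
leaf (this one imports the three route files). THEOREMS ONLY; no definition, no named fact, no `sorry`.

Honest framing: CONDITIONAL doors (seven named published facts as hypotheses: Gross–Zagier, Kolyvagin, Kolyvagin's
`Ш`-index bound, GZK over `ℚ`, the Modularity Theorem, Hoffstein–Luo, McCallum's certificate); item 20137 is a
permanently-open published-input pack and is NOT closed by this; no crux and no summit statement is proved; BSD is not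
proved by any of this. References: [Darmon2004] Thms. 3.6–3.7; [DiamondShurman2005] Thm. 8.8.3; [BCDTJAMS2001] Thm. A.
-/

namespace Summit.BirchSwinnertonDyer.BirchSwinnertonDyer.Theorems.PublishedInputsAdditiveKolySlim

open Literature.NumberTheory.EllipticCurves Literature.NumberTheory.EllipticCurves.ModularForms

/-- **`AdditiveKolyvaginRoad.PublishedInputsAdditiveKoly` (item 20137, BY NAME) from seven displayed inputs** —
Gross–Zagier, Kolyvagin, Kolyvagin's `Ш`-index bound, GZK over `ℚ`, the Modularity Theorem (newform currency),
Hoffstein–Luo, McCallum's structure certificate; the other three conjuncts are tree theorems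
(`publishedInputsAdditiveKoly_of_seven`). Conditional; closes nothing; BSD is not proved by this.
[cite: Darmon2004, Thms. 3.6–3.7] [cite: DiamondShurman2005, Thm. 8.8.3 with Thm. 5.10.2] -/
theorem additiveKolyvaginRoad_publishedInputsAdditiveKoly_of_seven
    (hGZ : ∀ (N : ℕ) [NeZero N] (W : WeierstrassCurve ℚ) (K : Type) [Field K] [NumberField K], gross_zagier N W K)
    (hKo : ∀ (N : ℕ) [NeZero N] (W : WeierstrassCurve ℚ) (K : Type) [Field K] [NumberField K], kolyvagin N W K)
    (hKo90 : ∀ (N : ℕ) [NeZero N] (W : WeierstrassCurve ℚ) (K : Type) [Field K] [NumberField K],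
      Kolyvagin1990_padicValNat_card_sha_le N W K)
    (hGZK : rank_eq_analyticRank_of_analyticRank_le_one) (hnf : exists_isNewformOf)
    (hHL : HoffsteinLuo1997_exists_twist_L_one_ne_zero)
    (hMc : McCallum1991_pow_dvd_card_sha_primary_of_certificate) :
    Summit.BirchSwinnertonDyer.BirchSwinnertonDyer.Theses.AdditiveKolyvaginRoad.PublishedInputsAdditiveKoly := by
  unfold Summit.BirchSwinnertonDyer.BirchSwinnertonDyer.Theses.AdditiveKolyvaginRoad.PublishedInputsAdditiveKoly
  exact publishedInputsAdditiveKoly_of_seven hGZ hKo hKo90 hGZK hnf hHL hMc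

/-- **`TeichmullerTwistDescent.PublishedInputsAdditiveKoly` (the same item 20137, BY NAME) from the same seven displayed
inputs** (`publishedInputsAdditiveKoly_of_seven`). Conditional; closes nothing; BSD is not proved by this.
[cite: Darmon2004, Thms. 3.6–3.7] [cite: DiamondShurman2005, Thm. 8.8.3 with Thm. 5.10.2] -/
theorem teichmullerTwistDescent_publishedInputsAdditiveKoly_of_seven
    (hGZ : ∀ (N : ℕ) [NeZero N] (W : WeierstrassCurve ℚ) (K : Type) [Field K] [NumberField K], gross_zagier N W K)
    (hKo : ∀ (N : ℕ) [NeZero N] (W : WeierstrassCurve ℚ) (K : Type) [Field K] [NumberField K], kolyvagin N W K)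
    (hKo90 : ∀ (N : ℕ) [NeZero N] (W : WeierstrassCurve ℚ) (K : Type) [Field K] [NumberField K],
      Kolyvagin1990_padicValNat_card_sha_le N W K)
    (hGZK : rank_eq_analyticRank_of_analyticRank_le_one) (hnf : exists_isNewformOf)
    (hHL : HoffsteinLuo1997_exists_twist_L_one_ne_zero)
    (hMc : McCallum1991_pow_dvd_card_sha_primary_of_certificate) :
    Summit.BirchSwinnertonDyer.BirchSwinnertonDyer.Theses.TeichmullerTwistDescent.PublishedInputsAdditiveKoly := by
  unfold Summit.BirchSwinnertonDyer.BirchSwinnertonDyer.Theses.TeichmullerTwistDescent.PublishedInputsAdditiveKoly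
  exact publishedInputsAdditiveKoly_of_seven hGZ hKo hKo90 hGZK hnf hHL hMc

/-- **`EdixhovenFibreFiveSeven.PublishedInputsAdditiveKoly` (the same item 20137, BY NAME) from the same seven displayed
inputs** (`publishedInputsAdditiveKoly_of_seven`). Conditional; closes nothing; BSD is not proved by this.
[cite: Darmon2004, Thms. 3.6–3.7] [cite: DiamondShurman2005, Thm. 8.8.3 with Thm. 5.10.2] -/
theorem edixhovenFibreFiveSeven_publishedInputsAdditiveKoly_of_seven
    (hGZ : ∀ (N : ℕ) [NeZero N] (W : WeierstrassCurve ℚ) (K : Type) [Field K] [NumberField K], gross_zagier N W K)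
    (hKo : ∀ (N : ℕ) [NeZero N] (W : WeierstrassCurve ℚ) (K : Type) [Field K] [NumberField K], kolyvagin N W K)
    (hKo90 : ∀ (N : ℕ) [NeZero N] (W : WeierstrassCurve ℚ) (K : Type) [Field K] [NumberField K],
      Kolyvagin1990_padicValNat_card_sha_le N W K)
    (hGZK : rank_eq_analyticRank_of_analyticRank_le_one) (hnf : exists_isNewformOf)
    (hHL : HoffsteinLuo1997_exists_twist_L_one_ne_zero)
    (hMc : McCallum1991_pow_dvd_card_sha_primary_of_certificate) :
    Summit.BirchSwinnertonDyer.BirchSwinnertonDyer.Theses.EdixhovenFibreFiveSeven.PublishedInputsAdditiveKoly := by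
  unfold Summit.BirchSwinnertonDyer.BirchSwinnertonDyer.Theses.EdixhovenFibreFiveSeven.PublishedInputsAdditiveKoly
  exact publishedInputsAdditiveKoly_of_seven hGZ hKo hKo90 hGZK hnf hHL hMc

end Summit.BirchSwinnertonDyer.BirchSwinnertonDyer.Theorems.PublishedInputsAdditiveKolySlim
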